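import Summits.MatrixMultiplication.OmegaCensus.STPP211CosetEngine

/-!
# (2,1,1)¹⁰ ⊄ (ℤ/2)⁶ — part D1: coset-law kernel decisions (#1, #2, #3, #4, #5)

Cell `pub-omega` (unit `pub-omega-stpp-1-g36`), topic `Summits/MatrixMultiplication/OmegaCensus`.
HONEST FRAMING (verbatim): lottery ticket; floor = certified bounds/negative ranges. Census STRUCTURE bookkeeping (B5, `T1((ℤ/2)⁶)`, Pb237);
nothing here is a bound on `ω`.

The `c`-code lists are representatives of the `AGL(6,2)`-classes of 10-subsets `C ∋ 0` of `𝔽₂⁶` (ENG2 g35's mass-formula-certified list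
`orbits_m6_k10.txt`; numbering = its line order). Classes of affine dimension `≤ 5` (all codes `< 32`): hyperplane «bit 5 = 0», threshold
`T = 10` (`csNN`). Classes #16, #24, #26 (affine dimension 6, nine of the ten points in the hyperplane «bit 0 = 0»): the nine EVEN codes,
threshold `T = 9` (`csNNi`). Each `decide +kernel` evaluates the SALTED search `T1CosetEng.searchS` (`STPP211CosetEngine`, v2); desk twins
`labm.c` / `engine_mirror.py` (HOME `pub-omega-stpp-1-g36/code/`) give the call counts quoted. The theorems these become: `STPP211Z2pow6CosetKills`
(via `STPP211CosetReflectB.cosetBound_of_searchS` and the coset law `STPP211CosetLaw`).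

References: H. Cohn, R. Kleinberg, B. Szegedy, C. Umans, FOCS 2005 (arXiv:math/0511460), Def. 5.1.
-/

namespace Summit.MatrixMultiplication.OmegaCensus

namespace T1CosetEng

/-- Class #1: the `c`-codes `0 1 2 3 4 5 8 10 12 14` (affine dimension ≤ 5). -/
def cs01 : List ℕ := [0, 1, 2, 3, 4, 5, 8, 10, 12, 14]

/-- KERNEL (110913 calls at the desk): no rooted admissible labeled set of class #1 in the hyperplane «bit 5 = 0» has 10 members. -/
theorem searchS_cs01 : searchS cs01 5 10 = true := by decide +kernel

/-- Class #2: the `c`-codes `0 1 2 3 4 5 8 10 12 15` (affine dimension ≤ 5). -/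
def cs02 : List ℕ := [0, 1, 2, 3, 4, 5, 8, 10, 12, 15]

/-- KERNEL (103463 calls at the desk): no rooted admissible labeled set of class #2 in the hyperplane «bit 5 = 0» has 10 members. -/
theorem searchS_cs02 : searchS cs02 5 10 = true := by decide +kernel

/-- Class #3: the `c`-codes `0 1 2 3 4 5 8 9 14 15` (affine dimension ≤ 5). -/
def cs03 : List ℕ := [0, 1, 2, 3, 4, 5, 8, 9, 14, 15]

/-- KERNEL (165745 calls at the desk): no rooted admissible labeled set of class #3 in the hyperplane «bit 5 = 0» has 10 members. -/
theorem searchS_cs03 : searchS cs03 5 10 = true := by decide +kernel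

/-- Class #4: the `c`-codes `0 1 2 3 4 5 8 9 16 17` (affine dimension ≤ 5). -/
def cs04 : List ℕ := [0, 1, 2, 3, 4, 5, 8, 9, 16, 17]

/-- KERNEL (61249 calls at the desk): no rooted admissible labeled set of class #4 in the hyperplane «bit 5 = 0» has 10 members. -/
theorem searchS_cs04 : searchS cs04 5 10 = true := by decide +kernel

/-- Class #5: the `c`-codes `0 1 2 3 4 8 12 16 21 26` (affine dimension ≤ 5). -/
def cs05 : List ℕ := [0, 1, 2, 3, 4, 8, 12, 16, 21, 26]

/-- KERNEL (136435 calls at the desk): no rooted admissible labeled set of class #5 in the hyperplane «bit 5 = 0» has 10 members. -/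
theorem searchS_cs05 : searchS cs05 5 10 = true := by decide +kernel

end T1CosetEng

end Summit.MatrixMultiplication.OmegaCensus
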